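import Summits.CriticalPhenomena.PercolationContinuityZ3.Theorems.SahiBoxTP2Split

/-!
# Box-TP₂ laws on the unit cube `Q_d` are almost-everywhere-monotone images of Lebesgue measure, every `d`

Support file of the Sahi cell (`prim-sahi`, typer seat, generation 11; `--supports stmt-CriticalPhenomena-4575`).

THE COUPLING THEOREM (`exists_aemonotone_coupling`): every box-TP₂ (`SahiBoxTP2Split.IsBoxTP2`) probability
measure `μ` on `Q_d = (Fin d → [0,1])` is `G_* λ_d` for a BOREL map `G : Q_d → Q_d` that is monotone (for the
coordinatewise order) on a set of full Lebesgue measure.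

Proof = the standard (Rosenblatt) construction by induction on `d`, one coordinate at a time: split off the last
coordinate (`SahiBoxTP2Split.lean`: the first `d` coordinates are again box-TP₂, and the cut condition
`IsBallTP2Cut` holds for the last one), couple the first `d` coordinates by induction, take the conditional kernel
of the last coordinate that is stochastically increasing on a full-measure set (`SahiBoxTP2Kernel.exists_aeCisKernel`,
Besicovitch differentiation on the cube), read it as a kernel into `[0,1]` (`compProd_map_projIcc_eq`,
`map_projIcc_Iic_le`), and append its fibrewise quantile (`exists_aemono_map_compProd` = the generation-9 step
`SahiLiebSahiContinuumKernel.exists_monotone_map_compProd` with "monotone" weakened to "monotone on a full-measure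
set" for both the map and the kernel).

Why only almost everywhere: for `d ≥ 2` a version of the conditional law that is monotone EVERYWHERE and Borel
need not exist (generation 10, `SahiTP2Kernel.lean`); the a.e. statement is exactly what Sahi positivity consumes
(`SahiBoxTP2Positivity.lean`: an upper envelope repairs the null set).  `MTP₂ ⇒ CIS ⇒ monotone standard
construction` for densities is [folklore] (Karlin–Rinott 1980; Rüschendorf 1981; Belzunce–Martínez-Riquelme–Mulero
2016, §1.3); the box form for singular laws in every dimension is this work.  No sorries, no new axioms.
-/

noncomputable section

namespace Summit.CriticalPhenomena.PercolationContinuityZ3.Theorems.SahiBoxTP2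

open MeasureTheory ProbabilityTheory Set Filter Topology Metric Function
open scoped ENNReal unitInterval

/-! ### A real-valued conditional kernel carried by `[0,1]`, read as a kernel into `[0,1]` -/

section Transfer

variable {α : Type*} [MeasurableSpace α]

omit [MeasurableSpace α] in
/-- The fibre of the image of `s` under `(y,v) ↦ (y,↑v)` over `a` is the clamping preimage of the fibre of `s`,
cut back to `[0,1]`. [folklore] -/
theorem mk_preimage_image_prodMap_coe (s : Set (α × I)) (a : α) :
    Prod.mk a ⁻¹' (Prod.map (id : α → α) ((↑) : I → ℝ) '' s) =
      projIcc (0 : ℝ) 1 zero_le_one ⁻¹' (Prod.mk a ⁻¹' s) ∩ Icc 0 1 := by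
  ext r
  simp only [mem_preimage, mem_image, mem_inter_iff, mem_Icc, Prod.exists, Prod.map_apply, id_eq, Prod.mk.injEq]
  constructor
  · rintro ⟨a', v, hmem, rfl, rfl⟩
    exact ⟨by rwa [projIcc_val], v.2.1, v.2.2⟩
  · rintro ⟨hmem, hr0, hr1⟩
    refine ⟨a, ⟨r, hr0, hr1⟩, ?_, rfl, rfl⟩
    rwa [projIcc_of_mem zero_le_one (show r ∈ Icc (0 : ℝ) 1 from ⟨hr0, hr1⟩)] at hmem

/-- **Transfer**: if `μ'.fst ⊗ₘ κ` is the law `μ'` with its `[0,1]`-coordinate read in `ℝ`, then `κ` is a.e.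
carried by `[0,1]` and `μ'.fst ⊗ₘ (projIcc ∘ κ) = μ'`. [folklore] -/
theorem compProd_map_projIcc_eq (μ' : Measure (α × I)) [IsFiniteMeasure μ'] (κ : Kernel α ℝ) [IsMarkovKernel κ]
    (h : μ'.fst ⊗ₘ κ = μ'.map (Prod.map (id : α → α) ((↑) : I → ℝ))) :
    μ'.fst ⊗ₘ (κ.map (projIcc (0 : ℝ) 1 zero_le_one)) = μ' := by
  have hproj : Measurable (projIcc (0 : ℝ) 1 zero_le_one) := continuous_projIcc.measurable
  haveI := Kernel.IsMarkovKernel.map κ hproj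
  have hF : MeasurableEmbedding (Prod.map (id : α → α) ((↑) : I → ℝ)) := measurableEmbedding_prodMap_coe
  have hcar : ∀ᵐ a ∂μ'.fst, κ a (Icc (0 : ℝ) 1)ᶜ = 0 := by
    have h0 : (μ'.fst ⊗ₘ κ) (univ ×ˢ (Icc (0 : ℝ) 1)ᶜ) = 0 := by
      rw [h, hF.map_apply]
      have he : Prod.map (id : α → α) ((↑) : I → ℝ) ⁻¹' (univ ×ˢ (Icc (0 : ℝ) 1)ᶜ) = ∅ :=
        Set.eq_empty_of_forall_notMem fun p hp => hp.2 p.2.2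
      rw [he, measure_empty]
    rw [Measure.compProd_apply_prod MeasurableSet.univ measurableSet_Icc.compl, Measure.restrict_univ,
      lintegral_eq_zero_iff (Kernel.measurable_coe κ measurableSet_Icc.compl)] at h0
    filter_upwards [h0] with a ha using ha
  ext s hs
  have hμ's : μ' s = (μ'.fst ⊗ₘ κ) (Prod.map (id : α → α) ((↑) : I → ℝ) '' s) := by
    rw [h, hF.map_apply, Set.preimage_image_eq _ hF.injective]
  rw [Measure.compProd_apply hs, hμ's, Measure.compProd_apply (hF.measurableSet_image.2 hs)]
  refine lintegral_congr_ae ?_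
  filter_upwards [hcar] with a ha
  rw [Kernel.map_apply' κ hproj a (measurable_prodMk_left hs), mk_preimage_image_prodMap_coe,
    measure_inter_conull ha]

/-- **The transferred kernel inherits stochastic monotonicity**: `κ_b((-∞,t]) ≤ κ_a((-∞,t])` for all real `t`
gives `(projIcc ∘ κ)_b([0,y]) ≤ (projIcc ∘ κ)_a([0,y])` for all `y ∈ [0,1]`. [folklore] -/
theorem map_projIcc_Iic_le (κ : Kernel α ℝ) [IsMarkovKernel κ] {a b : α}
    (hab : ∀ t : ℝ, κ b (Iic t) ≤ κ a (Iic t)) (y : I) :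
    κ.map (projIcc (0 : ℝ) 1 zero_le_one) b (Iic y) ≤ κ.map (projIcc (0 : ℝ) 1 zero_le_one) a (Iic y) := by
  have hproj : Measurable (projIcc (0 : ℝ) 1 zero_le_one) := continuous_projIcc.measurable
  rw [Kernel.map_apply' κ hproj b measurableSet_Iic, Kernel.map_apply' κ hproj a measurableSet_Iic]
  rcases lt_or_ge (y : ℝ) 1 with hy | hy
  · have hset : projIcc (0 : ℝ) 1 zero_le_one ⁻¹' Iic y = Iic (y : ℝ) := by
      ext r
      simp only [mem_preimage, mem_Iic]
      rw [← Subtype.coe_le_coe, coe_projIcc]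
      constructor
      · intro hr
        rcases min_le_iff.1 ((le_max_right _ _).trans hr) with h1 | h1
        · exact absurd (h1.trans_lt hy) (lt_irrefl _)
        · exact h1
      · intro hr
        exact max_le y.2.1 (min_le_of_right_le hr)
    rw [hset]
    exact hab y
  · have hset : projIcc (0 : ℝ) 1 zero_le_one ⁻¹' Iic y = univ := by
      refine Set.eq_univ_of_forall fun r => ?_
      simp only [mem_preimage, mem_Iic]
      exact Subtype.coe_le_coe.1 ((projIcc 0 1 zero_le_one r).2.2.trans hy)
    rw [hset, measure_univ, measure_univ]

end Transfer

/-! ### The standard construction, one step, almost-everywhere-monotone version -/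

section Step

variable {d : ℕ}

/-- **The standard construction, one a.e. step.** If `μ = G_* λ_d` for a measurable `G : Q_d → α` monotone on a
set of full measure, and `κ : α → [0,1]` is a Markov kernel stochastically increasing on a set `T` of full
`μ`-measure, then `μ ⊗ₘ κ` on `α × [0,1]` is `G'_* λ_{d+1}` for a measurable `G' : Q_{d+1} → α × [0,1]` monotone on
a set of full measure (namely `x ↦ (G x', q_{κ(G x')}(x_d))`). [this work] -/
theorem exists_aemono_map_compProd {α : Type*} [MeasurableSpace α] [Preorder α] {G : (Fin d → I) → α}
    (hGm : Measurable G) {S : Set (Fin d → I)} (hS : ∀ᵐ x ∂(volume : Measure (Fin d → I)), x ∈ S)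
    (hG : MonotoneOn G S) (κ : Kernel α I) [IsMarkovKernel κ] {T : Set α}
    (hT : ∀ᵐ a ∂((volume : Measure (Fin d → I)).map G), a ∈ T)
    (hκ : ∀ ⦃a b : α⦄, a ∈ T → b ∈ T → a ≤ b → ∀ x : I, κ b (Iic x) ≤ κ a (Iic x)) :
    ∃ G' : (Fin (d + 1) → I) → α × I, ∃ S' : Set (Fin (d + 1) → I), Measurable G' ∧
      (∀ᵐ x ∂(volume : Measure (Fin (d + 1) → I)), x ∈ S') ∧ MonotoneOn G' S' ∧
      (volume : Measure (Fin (d + 1) → I)).map G' = ((volume : Measure (Fin d → I)).map G) ⊗ₘ κ := by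
  set e := splitLast d with he
  set Ψ : I × (Fin d → I) → α × I := fun q => (G q.2, KernelQuantile.kq κ (G q.2, q.1)) with hΨ
  have hstep : Measurable fun p : α × I => (p.1, KernelQuantile.kq κ p) :=
    measurable_fst.prodMk (KernelQuantile.measurable_kq κ)
  have hGid : Measurable (Prod.map G (id : I → I)) := hGm.prodMap measurable_id
  have hΨeq : Ψ = ((fun p : α × I => (p.1, KernelQuantile.kq κ p)) ∘ Prod.map G id) ∘ Prod.swap := by
    funext q; rfl
  have hΨm : Measurable Ψ := by
    rw [hΨeq]; exact (hstep.comp hGid).comp measurable_swap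
  have hev : (volume : Measure (Fin (d + 1) → I)).map e = (volume : Measure I).prod volume :=
    (volume_preserving_piFinSuccAbove (fun _ : Fin (d + 1) => I) (Fin.last d)).map_eq
  set S₂ : Set (Fin d → I) := {y | y ∈ S ∧ G y ∈ T} with hS₂
  have hS₂ae : ∀ᵐ y ∂(volume : Measure (Fin d → I)), y ∈ S₂ := by
    filter_upwards [hS, ae_of_ae_map hGm.aemeasurable hT] with y h1 h2 using ⟨h1, h2⟩
  refine ⟨Ψ ∘ e, {x | (e x).2 ∈ S₂}, hΨm.comp e.measurable, ?_, ?_, ?_⟩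
  · have hprod : ∀ᵐ p ∂((volume : Measure I).prod (volume : Measure (Fin d → I))), p.2 ∈ S₂ := by
      rw [ae_iff]
      have hset : {p : I × (Fin d → I) | ¬ p.2 ∈ S₂} = univ ×ˢ S₂ᶜ := by
        ext p
        simp only [mem_setOf_eq, mem_prod, mem_univ, mem_compl_iff, true_and]
      have h0 : (volume : Measure (Fin d → I)) S₂ᶜ = 0 := ae_iff.1 hS₂ae
      rw [hset, Measure.prod_prod, h0, mul_zero]
    rw [← hev] at hprod
    exact ae_of_ae_map e.measurable.aemeasurable hprod
  · intro x hx y hy hxy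
    have hexy : e x ≤ e y := splitLast_mono hxy
    have hG2 : G (e x).2 ≤ G (e y).2 := hG hx.1 hy.1 hexy.2
    refine ⟨hG2, ?_⟩
    change KernelQuantile.kq κ (G (e x).2, (e x).1) ≤ KernelQuantile.kq κ (G (e y).2, (e y).1)
    rw [KernelQuantile.kq_apply, KernelQuantile.kq_apply]
    exact (UnitIntervalQuantile.quantile_mono (κ (G (e x).2)) hexy.1).trans
      (UnitIntervalQuantile.quantile_mono_measure _ _ (hκ hx.2 hy.2 hG2) _)
  · rw [← Measure.map_map hΨm e.measurable, hev, hΨeq, ← Measure.map_map (hstep.comp hGid) measurable_swap,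
      Measure.prod_swap, ← Measure.map_map hstep hGid, ← Measure.map_prod_map _ _ hGm measurable_id,
      Measure.map_id, KernelQuantile.map_prod_kq]

end Step

/-! ### The coupling theorem -/

/-- **THE COUPLING THEOREM.** Every box-TP₂ probability measure `μ` on the unit cube `Q_d` (every `d`) is the
image of Lebesgue measure `λ_d` under a Borel map `G : Q_d → Q_d` that is monotone, for the coordinatewise order,
on a set of full Lebesgue measure: `μ = G_* λ_d`.  (The standard construction by induction on the dimension:
split off the last coordinate, couple the first `d` by induction, and append the quantile of the a.e.-monotone
conditional kernel of `SahiBoxTP2Kernel.exists_aeCisKernel`.) [this work] -/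
theorem exists_aemonotone_coupling (d : ℕ) :
    ∀ (μ : Measure (Fin d → I)) [IsProbabilityMeasure μ], IsBoxTP2 μ →
      ∃ G : (Fin d → I) → (Fin d → I), ∃ S : Set (Fin d → I), Measurable G ∧
        (∀ᵐ x ∂(volume : Measure (Fin d → I)), x ∈ S) ∧ MonotoneOn G S ∧
        (volume : Measure (Fin d → I)).map G = μ := by
  induction d with
  | zero =>
    intro μ _ _
    refine ⟨id, univ, measurable_id, ae_of_all _ fun x => mem_univ x, monotoneOn_id, ?_⟩
    rw [Measure.map_id]
    ext s hs
    by_cases hne : s.Nonempty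
    · rw [Subsingleton.eq_univ_of_nonempty hne, measure_univ, measure_univ]
    · rw [not_nonempty_iff_eq_empty.1 hne, measure_empty, measure_empty]
  | succ d ih =>
    intro μ _ hμ
    obtain ⟨G, S, hGm, hS, hG, hGν⟩ := ih (μ.map initLast).fst hμ.fst_initLast
    obtain ⟨κ, hκM, hdis, T, hT, hκmono⟩ := exists_aeCisKernel hμ.isBallTP2Cut_lawInitLastReal
    rw [fst_lawInitLastReal] at hdis hT
    have hproj : Measurable (projIcc (0 : ℝ) 1 zero_le_one) := continuous_projIcc.measurable
    haveI := Kernel.IsMarkovKernel.map κ hproj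
    have hcomp : (μ.map initLast).fst ⊗ₘ (κ.map (projIcc (0 : ℝ) 1 zero_le_one)) = μ.map initLast :=
      compProd_map_projIcc_eq (μ.map initLast) κ hdis
    have hT' : ∀ᵐ a ∂((volume : Measure (Fin d → I)).map G), a ∈ T := by rwa [hGν]
    obtain ⟨G', S', hG'm, hS', hG'mono, hG'eq⟩ := exists_aemono_map_compProd hGm hS hG
      (κ.map (projIcc (0 : ℝ) 1 zero_le_one)) hT'
      (fun a b ha hb hab y => map_projIcc_Iic_le κ (hκmono ha hb hab) y)
    have hsw : Measurable fun p : (Fin d → I) × I => (splitLast d).symm (p.2, p.1) :=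
      (splitLast d).symm.measurable.comp measurable_swap
    refine ⟨(fun p : (Fin d → I) × I => (splitLast d).symm (p.2, p.1)) ∘ G', S', hsw.comp hG'm, hS', ?_, ?_⟩
    · intro x hx y hy hxy
      have h := hG'mono hx hy hxy
      exact splitLast_symm_mono (d := d) (show ((G' x).2, (G' x).1) ≤ ((G' y).2, (G' y).1) from ⟨h.2, h.1⟩)
    · rw [← Measure.map_map hsw hG'm, hG'eq, hGν, hcomp, Measure.map_map hsw measurable_initLast]
      convert Measure.map_id (μ := μ) using 2
      funext x
      exact (splitLast d).symm_apply_apply x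

end Summit.CriticalPhenomena.PercolationContinuityZ3.Theorems.SahiBoxTP2
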